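import Summits.QuantumFields.BalabanUV.Beta.GAN24.TaylorRowLamTopTable
import Summits.QuantumFields.BalabanUV.Beta.GAN24.TaylorMassLamAt
import Summits.QuantumFields.BalabanUV.Beta.GAN24.TaylorLamBracketAt

/-!
# `BalabanUV.Beta.GAN24.TaylorRowLamTopTableAt` — binder row G-an2-4 / (CONV-C), road S3 AT THE IN-BLOCK ROOT: package (ρ-d), part 1 of 4, of the row owner
# gan24-p1-g21's WANTED «ROOTED-S3-Λ» ([GAN24P1-G21-ONLINE] (W5), journal `CLAIMS.log` l.34168; «MINE (ρ-d)» leaf-04 g55 l.34353, OWNER GO (W8) l.34364) —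
# **`TaylorRowLamTopTable` RE-RUN FOR an1's ROOTED TABLE**: the synthetic table of the top Λ row read at the lattice points, now built on the ROOTED lifted
# one-step constraint Hessian `avgLift M (hessFFAt (toSite r) Lc μ Y)` and the ROOTED Lagrange increment `lagrIncAt d (toSite r) Lc M N` (box root `r ∈ box (d+1) Lc`);
# its supports, radii, pointwise size and per-`y` mass, and the Λ vertex in `TaylorSandwich.sandwich_bound`'s shape — SAME constants as the base module
# (they are root-uniform), so part 2 `GAN24/TaylorRowLamTopAt` gets ROW S3-Lt with its constant BEFORE the root.

NOT IN PRINT; OUR BOOKKEEPING (G-an2-4 formalisation swarm → CRUX TEAM (2), leaf prover `b2b-balaban-gan24-formalise-leaf-04`, gen 55).  METHOD = the owner's gen-6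
`mkroot.py` rule, executed by the static script `HOME/b2b-balaban-gan24-formalise-leaf-04/g55/rho-d/mk_toptable_at.py` on the TREE text of `GAN24/TaylorRowLamTopTable`
(holder leaf-10, gen 12): base text from `noncomputable section` on; namespace `…TaylorRowLamTopTable` → `…TaylorRowLamTopTableAt`; `hessFF ↦ hessFFAt (toSite r)`,
`lagrInc d Lc ↦ SpineRooted.lagrIncAt d (toSite r) Lc`; the plumbing table `tabT` takes the root `r` as its first argument (same name, this namespace); leaf-01 g60's
(ρ-a) `TaylorMassLamAt.abs_avgLift_hessFFAt_le` ∕ `avgLift_hessFFAt_ne_zero` and (ρ-b) `TaylorLamBracketAt.vertex_lagrIncAt_top` replace leaf-11's ∕ leaf-10's base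
lemmas, each with ONE extra binder `(hr : r ∈ box (d+1) Lc)` right after `hLc`; the root-free §2 helpers (`abs_apply_le_l1`, `l1_le_of_mem_cube`, `mem_cube_of_l1_le`,
`suppU`, `suppW`, `card_suppU_le`, `card_suppW_le`, `l1_sub_le_of_mem_suppU`, `l1_sub_le_of_mem_suppW`) are used BY NAME from the base module, NOT re-declared;
SAME theorem names and SAME constants as the base module; base module untouched.  [folklore] bookkeeping; ONE plumbing `def` (`tabT`, the rooted table — asserts
nothing), 0 cited facts, 0 `def … : Prop`, 0 sorry; NO estimate of (N1)∕(N3) or of Bałaban's.  HONEST FRAMING (cell contract, verbatim): «discharging `BetaPertH`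
makes Bałaban's UV stability UNCONDITIONAL — a real constructive-QFT result; it is NOT the continuum limit and NOT the Clay problem.»  HONEST DEPENDENCY (verbatim):
«continuum YM on T⁴ ⇐ BetaPertH ∧ nine spine estimates (0/9 proved); BetaPertH ⇐ (D1) ∧ (D4) ∧ CAP+tail; G-an2-4 gates asym, D1 and NE2/3/4.»  Discharges NOTHING
of (hS, hSall) by itself; hB ∕ hUg OPEN (the owner's `BornLambdaUndressedRow.exists_hUg_of_rootedRows` consumes part 2's END as `hLt`); NEVER «G-an2-4 closed»;
NOT (CONV-C), NOT D1, NOT BetaPertH, NOT continuum, NOT Clay.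

WHAT IS PROVED ([folklore], 0 sorry; every statement = the base's with the rooted objects): §1 `tabT` (rooted) + `tabT_zsmul` ∕ `tabT_off`, `tsum_reindex`,
**`vertex_sandwich_form (hLc) (hr)`**; §2 `tabT_support (hLc) (hr)`, `mem_suppU_of_ne_zero (hLc) (hr)`, `mem_suppW_of_ne_zero (hLc) (hr)`, `abs_tabT_le (hLc) (hr)`
(`≤ 2ℓ²∕M^{2(d+1)}`), **`mass_tabT_le (hLc) (hr)`** (per-`y` mass `≤ (2K₂+1)^{d+1}(d+1)²(2K+1)^{d+1}·2ℓ²∕M^{2(d+1)}` — root-free constant).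
-/

noncomputable section

open Finset
open scoped BigOperators
open Literature.MathematicalPhysics.QuantumFieldTheory
open Literature.MathematicalPhysics.QuantumFieldTheory.LatticeForm (quo)
open Literature.Probability.LatticeModels (Torus.proj)
open Literature.MathematicalPhysics.QuantumFieldTheory.Balaban1983to89
open Literature.MathematicalPhysics.QuantumFieldTheory.Balaban1983to89.Beta
open B12Sec2to5 (l1 l1_nonneg)
open ExpKernelCalculus (MKer l1_sub_symm l1_sub_triangle l1_natSmul)
open AffineAveraging (Site box toSite)
open OneStepResolventKernel (Fib KInv proj_zsmul quo_zsmul eq_zsmul_quo_of_proj)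
open KernelSpecInstance (wH wΦ)
open InterLevelTransport (avgLift onLat onLat_zsmul onLat_off)
open BalabanCompositeJets (l1_sub_zsmul_quo_le)
open AveragingHessianKernels (ell)
open AveragingHessianKernelsRooted (hessFFAt)
open Summit.QuantumFields.BalabanUV.Beta.SpineRooted (lagrIncAt)
open Summit.QuantumFields.BalabanUV.Beta.AxialDressingRooted (cube mem_cube card_cube)
open Summit.QuantumFields.BalabanUV.Beta.GAN24.TaylorLamBracketAt (vertex_lagrIncAt_top)
open Summit.QuantumFields.BalabanUV.Beta.GAN24.TaylorMassLamAt (abs_avgLift_hessFFAt_le avgLift_hessFFAt_ne_zero)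
open Summit.QuantumFields.BalabanUV.Beta.GAN24.TaylorRowLamTopTable (abs_apply_le_l1 l1_le_of_mem_cube mem_cube_of_l1_le suppU suppW card_suppU_le card_suppW_le
  l1_sub_le_of_mem_suppU l1_sub_le_of_mem_suppW)
open Summit.QuantumFields.BalabanUV.Beta.GAN24.TaylorBlockSum (l1_quo_sub_quo_le)

namespace Summit.QuantumFields.BalabanUV.Beta.GAN24.TaylorRowLamTopTableAt

variable {d : ℕ}

/-! ## §1 The lifted Hessian table read at the lattice points, and the vertex in `sandwich_bound`'s shape -/

section Table

variable {Lc M N : ℕ} {r : Fin (d + 1) → ℕ}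

/-- [folklore] THE SYNTHETIC TABLE: an1's lifted ROOTED one-step constraint Hessian `avgLift M (hessFFAt (toSite r) Lc μ Y)` (box root `r`) read at the lattice point `u = N•Y` of its coarse
bond (zero off `N•ℤ^{d+1}`), field–field block, in the argument order of `TaylorSandwich.sandwich_bound`'s `T`. Plumbing only; asserts nothing. -/
def tabT (r : Fin (d + 1) → ℕ) (Lc M N : ℕ) (μ : Fin (d + 1)) (u w : Site (d + 1)) (l : Fin (d + 1)) (y : Site (d + 1)) (l' : Fin (d + 1)) : ℝ :=
  onLat N (fun Y => avgLift M (hessFFAt (toSite r) (d := d) Lc μ Y)) u w y (Sum.inl l) (Sum.inl l')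

/-- [folklore] On the lattice the table reads the lifted Hessian. -/
theorem tabT_zsmul [NeZero N] (μ : Fin (d + 1)) (Y w : Site (d + 1)) (l : Fin (d + 1)) (y : Site (d + 1)) (l' : Fin (d + 1)) :
    tabT r Lc M N μ ((N : ℤ) • Y) w l y l' = avgLift M (hessFFAt (toSite r) (d := d) Lc μ Y) w y (Sum.inl l) (Sum.inl l') := by
  simp only [tabT, onLat_zsmul]

/-- [folklore] Off the lattice the table vanishes. -/
theorem tabT_off {u : Site (d + 1)} (hu : Torus.proj N u ≠ 0) (μ : Fin (d + 1)) (w : Site (d + 1)) (l : Fin (d + 1)) (y : Site (d + 1))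
    (l' : Fin (d + 1)) : tabT r Lc M N μ u w l y l' = 0 := by
  simp only [tabT, onLat_off _ hu]
  rfl

/-- [folklore] RE-INDEXING the coarse superposition onto the lattice points: `Σ'_u (c·wΦ_N κ′ μ (u′ − quo N u))·tabT μ u = Σ'_Y (c·wΦ_N κ′ μ (u′ − Y))·avgLift M (hessFFAt (toSite r) Lc μ Y)`. -/
theorem tsum_reindex [NeZero N] (c : ℝ) (κ' μ : Fin (d + 1)) (u' w y : Site (d + 1)) (l l' : Fin (d + 1)) :
    ∑' u, (c * wΦ (N := N) κ' μ (u' - quo N u)) * tabT r Lc M N μ u w l y l' =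
      ∑' Y, (c * wΦ (N := N) κ' μ (u' - Y)) * avgLift M (hessFFAt (toSite r) (d := d) Lc μ Y) w y (Sum.inl l) (Sum.inl l') := by
  have hinj : Function.Injective (fun Y : Site (d + 1) => (N : ℤ) • Y) := fun Y Y' h => by
    have h2 := congrArg (quo N) h
    simpa only [quo_zsmul] using h2
  rw [← hinj.tsum_eq (f := fun u => (c * wΦ (N := N) κ' μ (u' - quo N u)) * tabT r Lc M N μ u w l y l')]
  · exact tsum_congr fun Y => by simp only [quo_zsmul, tabT_zsmul]
  · intro v hv
    by_cases h0 : Torus.proj N v = 0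
    · exact ⟨quo N v, (eq_zsmul_quo_of_proj (N := N) h0).symm⟩
    · refine (Function.mem_support.mp hv ?_).elim
      show (c * wΦ (N := N) κ' μ (u' - quo N v)) * tabT r Lc M N μ v w l y l' = 0
      rw [tabT_off h0, mul_zero]

/-- [folklore] **THE Λ VERTEX IN `sandwich_bound`'s SHAPE** (top level, any scalars `c₁, c₂`): by leaf-01's rooted `TaylorLamBracketAt.vertex_lagrIncAt_top` and `tsum_reindex`,
`Σ_{κ″} c₁·Σ'_u (c₂·wH_N κ″ κ′ (u − N•u′))·lagrIncAt(ρ)(κ″,u)(w,y,l,l′) = Σ_μ c₁·Σ'_u (c₂·wΦ_N κ′ μ (u′ − quo N u))·tabT μ u w l y l′`. -/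
theorem vertex_sandwich_form [NeZero N] [NeZero M] (hLc : 1 ≤ Lc) (hr : r ∈ box (d + 1) Lc) (c₁ c₂ : ℝ) (κ' : Fin (d + 1)) (u' w y : Site (d + 1)) (l l' : Fin (d + 1)) :
    ∑ κ'', c₁ * ∑' u, (c₂ * wH (N := N) κ'' κ' (u - (N : ℤ) • u')) * lagrIncAt d (toSite r) Lc M N κ'' u w y (Sum.inl l) (Sum.inl l') =
      ∑ μ, c₁ * ∑' u, (c₂ * wΦ (N := N) κ' μ (u' - quo N u)) * tabT r Lc M N μ u w l y l' := by
  have hL : ∀ κ'', ∑' u, (c₂ * wH (N := N) κ'' κ' (u - (N : ℤ) • u')) * lagrIncAt d (toSite r) Lc M N κ'' u w y (Sum.inl l) (Sum.inl l') =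
      c₂ * ∑' u, wH (N := N) κ'' κ' (u - (N : ℤ) • u') * lagrIncAt d (toSite r) Lc M N κ'' u w y (Sum.inl l) (Sum.inl l') := by
    intro κ''; rw [← tsum_mul_left]; exact tsum_congr fun u => by ring
  have hR : ∀ μ, ∑' u, (c₂ * wΦ (N := N) κ' μ (u' - quo N u)) * tabT r Lc M N μ u w l y l' =
      c₂ * ∑' Y, wΦ (N := N) κ' μ (u' - Y) * avgLift M (hessFFAt (toSite r) (d := d) Lc μ Y) w y (Sum.inl l) (Sum.inl l') := by
    intro μ; rw [tsum_reindex, ← tsum_mul_left]; exact tsum_congr fun Y => by ring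
  calc ∑ κ'', c₁ * ∑' u, (c₂ * wH (N := N) κ'' κ' (u - (N : ℤ) • u')) * lagrIncAt d (toSite r) Lc M N κ'' u w y (Sum.inl l) (Sum.inl l')
      = ∑ κ'', (c₁ * c₂) * ∑' u, wH (N := N) κ'' κ' (u - (N : ℤ) • u') * lagrIncAt d (toSite r) Lc M N κ'' u w y (Sum.inl l) (Sum.inl l') := by
        refine Finset.sum_congr rfl fun κ'' _ => ?_
        rw [hL]; ring
    _ = (c₁ * c₂) * ∑ μ, ∑' Y, wΦ (N := N) κ' μ (u' - Y) * avgLift M (hessFFAt (toSite r) (d := d) Lc μ Y) w y (Sum.inl l) (Sum.inl l') := by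
        rw [← Finset.mul_sum, vertex_lagrIncAt_top M hLc hr]
    _ = ∑ μ, c₁ * ∑' u, (c₂ * wΦ (N := N) κ' μ (u' - quo N u)) * tabT r Lc M N μ u w l y l' := by
        rw [Finset.mul_sum]
        refine Finset.sum_congr rfl fun μ _ => ?_
        rw [hR]; ring

end Table

/-! ## §2 Supports and the per-`y` mass of the synthetic table (generic `d`, `N = M·Lc`) -/

section Support

variable {Lc M N : ℕ} [NeZero M] [NeZero N] {r : Fin (d + 1) → ℕ}

/-- [folklore] SUPPORT OF THE TABLE: a nonzero entry sits at a lattice point `u = N•(quo N u)` with both field legs `w, y` within `ℓ¹`-distance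
`2(d+1)(Lc+1)·M` of `u` (leaf-01's rooted `avgLift_hessFFAt_ne_zero`, `N = M·Lc`). -/
theorem tabT_support (hLc : 1 ≤ Lc) (hr : r ∈ box (d + 1) Lc) (hN : N = M * Lc) {μ : Fin (d + 1)} {u w : Site (d + 1)} {l : Fin (d + 1)} {y : Site (d + 1)}
    {l' : Fin (d + 1)} (h : tabT r Lc M N μ u w l y l' ≠ 0) :
    u = (N : ℤ) • quo N u ∧ l1 (w - u) ≤ 2 * ((d : ℝ) + 1) * (Lc + 1) * M ∧ l1 (y - u) ≤ 2 * ((d : ℝ) + 1) * (Lc + 1) * M := by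
  by_cases h0 : Torus.proj N u = 0
  · have hu : u = (N : ℤ) • quo N u := eq_zsmul_quo_of_proj (N := N) h0
    have h1 : tabT r Lc M N μ u w l y l' = avgLift M (hessFFAt (toSite r) (d := d) Lc μ (quo N u)) w y (Sum.inl l) (Sum.inl l') := by
      conv_lhs => rw [hu]
      rw [tabT_zsmul]
    rw [h1] at h
    have h2 := avgLift_hessFFAt_ne_zero M hLc hr h
    have h3 : ((M * Lc : ℕ) : ℤ) • quo N u = u := by rw [← hN]; exact hu.symm
    rw [h3] at h2
    exact ⟨hu, h2.1, h2.2⟩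
  · exact absurd (tabT_off h0 μ w l y l') h

/-- [folklore] A nonzero table entry has its lattice point in `suppU` (radius `K ≥ 2(d+1)(Lc+1) + (d+1)` in the block index). -/
theorem mem_suppU_of_ne_zero (hLc : 1 ≤ Lc) (hr : r ∈ box (d + 1) Lc) (hN : N = M * Lc) {K : ℕ} (hK : 2 * ((d : ℝ) + 1) * (Lc + 1) + ((d : ℝ) + 1) ≤ K)
    {μ : Fin (d + 1)} {u w : Site (d + 1)} {l : Fin (d + 1)} {y : Site (d + 1)} {l' : Fin (d + 1)} (h : tabT r Lc M N μ u w l y l' ≠ 0) :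
    u ∈ suppU d N K y := by
  obtain ⟨hu, -, hy⟩ := tabT_support hLc hr hN h
  rw [suppU, Finset.mem_image]
  refine ⟨quo N u - quo N y, mem_cube_of_l1_le ?_, by rw [add_sub_cancel]; exact hu.symm⟩
  have hNpos : (0 : ℝ) < N := by exact_mod_cast Nat.pos_of_ne_zero (NeZero.ne N)
  have hM : (M : ℝ) ≤ N := by
    rw [hN]; push_cast
    have h1 : (1 : ℝ) ≤ Lc := by exact_mod_cast hLc
    have hM0 : (0 : ℝ) ≤ M := Nat.cast_nonneg M
    nlinarith [h1, hM0]
  have h1 := l1_quo_sub_quo_le (N := N) u y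
  have h2 : l1 (u - y) / N ≤ 2 * ((d : ℝ) + 1) * (Lc + 1) := by
    rw [div_le_iff₀ hNpos, l1_sub_symm]
    calc l1 (y - u) ≤ 2 * ((d : ℝ) + 1) * (Lc + 1) * M := hy
      _ ≤ 2 * ((d : ℝ) + 1) * (Lc + 1) * N := mul_le_mul_of_nonneg_left hM (by positivity)
  have h3 : ((d + 1 : ℕ) : ℝ) = (d : ℝ) + 1 := by push_cast; ring
  rw [h3] at h1
  linarith

omit [NeZero N] in
/-- [folklore] A nonzero table entry has its `w`-leg in `suppW` (radius `K₂ ≥ 4(d+1)(Lc+1)·M` in fine units). -/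
theorem mem_suppW_of_ne_zero [NeZero N] (hLc : 1 ≤ Lc) (hr : r ∈ box (d + 1) Lc) (hN : N = M * Lc) {K₂ : ℕ} (hK : 4 * ((d : ℝ) + 1) * (Lc + 1) * M ≤ K₂)
    {μ : Fin (d + 1)} {u w : Site (d + 1)} {l : Fin (d + 1)} {y : Site (d + 1)} {l' : Fin (d + 1)} (h : tabT r Lc M N μ u w l y l' ≠ 0) :
    w ∈ suppW d K₂ y := by
  obtain ⟨-, hw, hy⟩ := tabT_support hLc hr hN h
  rw [suppW, Finset.mem_image]
  refine ⟨w - y, mem_cube_of_l1_le ?_, by abel⟩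
  have h1 := l1_sub_triangle w u y
  rw [l1_sub_symm u y] at h1
  linarith

/-- [folklore] POINTWISE SIZE of the table: `≤ 2ℓ²∕M^{2(d+1)}` (leaf-01's rooted `abs_avgLift_hessFFAt_le`; zero off the lattice). -/
theorem abs_tabT_le (hLc : 1 ≤ Lc) (hr : r ∈ box (d + 1) Lc) (μ : Fin (d + 1)) (u w : Site (d + 1)) (l : Fin (d + 1)) (y : Site (d + 1)) (l' : Fin (d + 1)) :
    |tabT r Lc M N μ u w l y l'| ≤ 2 * (ell (d + 1) Lc : ℝ) ^ 2 / (M : ℝ) ^ (2 * (d + 1)) := by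
  by_cases h0 : Torus.proj N u = 0
  · have hu : u = (N : ℤ) • quo N u := eq_zsmul_quo_of_proj (N := N) h0
    rw [hu, tabT_zsmul]
    exact abs_avgLift_hessFFAt_le M hLc hr μ _ w y _ _
  · rw [tabT_off h0, abs_zero]; positivity

/-- [folklore] **THE PER-`y` MASS OF THE TABLE** over the supports: `≤ (2K₂+1)^{d+1}·(d+1)·(d+1)·(2K+1)^{d+1}·2ℓ²∕M^{2(d+1)}`. -/
theorem mass_tabT_le (hLc : 1 ≤ Lc) (hr : r ∈ box (d + 1) Lc) (K K₂ : ℕ) (y : Site (d + 1)) (l' : Fin (d + 1)) :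
    ∑ w ∈ suppW d K₂ y, ∑ l : Fin (d + 1), ∑ μ : Fin (d + 1), ∑ u ∈ suppU d N K y, |tabT r Lc M N μ u w l y l'| ≤
      ((2 * K₂ + 1 : ℕ) : ℝ) ^ (d + 1) * (((d : ℝ) + 1) * (((d : ℝ) + 1) * (((2 * K + 1 : ℕ) : ℝ) ^ (d + 1) *
        (2 * (ell (d + 1) Lc : ℝ) ^ 2 / (M : ℝ) ^ (2 * (d + 1)))))) := by
  set B := 2 * (ell (d + 1) Lc : ℝ) ^ 2 / (M : ℝ) ^ (2 * (d + 1)) with hB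
  have hB0 : 0 ≤ B := by positivity
  have hu : ∀ w l μ, ∑ u ∈ suppU d N K y, |tabT r Lc M N μ u w l y l'| ≤ ((2 * K + 1 : ℕ) : ℝ) ^ (d + 1) * B := by
    intro w l μ
    calc ∑ u ∈ suppU d N K y, |tabT r Lc M N μ u w l y l'| ≤ ∑ _u ∈ suppU d N K y, B :=
          Finset.sum_le_sum fun u _ => abs_tabT_le hLc hr μ u w l y l'
      _ = (suppU d N K y).card * B := by rw [Finset.sum_const, nsmul_eq_mul]
      _ ≤ ((2 * K + 1 : ℕ) : ℝ) ^ (d + 1) * B := mul_le_mul_of_nonneg_right (card_suppU_le K y) hB0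
  have hμ : ∀ w l, ∑ μ : Fin (d + 1), ∑ u ∈ suppU d N K y, |tabT r Lc M N μ u w l y l'| ≤
      ((d : ℝ) + 1) * (((2 * K + 1 : ℕ) : ℝ) ^ (d + 1) * B) := by
    intro w l
    calc ∑ μ : Fin (d + 1), ∑ u ∈ suppU d N K y, |tabT r Lc M N μ u w l y l'| ≤ ∑ _μ : Fin (d + 1), ((2 * K + 1 : ℕ) : ℝ) ^ (d + 1) * B :=
          Finset.sum_le_sum fun μ _ => hu w l μ
      _ = ((d : ℝ) + 1) * (((2 * K + 1 : ℕ) : ℝ) ^ (d + 1) * B) := by simp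
  have hl : ∀ w, ∑ l : Fin (d + 1), ∑ μ : Fin (d + 1), ∑ u ∈ suppU d N K y, |tabT r Lc M N μ u w l y l'| ≤
      ((d : ℝ) + 1) * (((d : ℝ) + 1) * (((2 * K + 1 : ℕ) : ℝ) ^ (d + 1) * B)) := by
    intro w
    calc ∑ l : Fin (d + 1), ∑ μ : Fin (d + 1), ∑ u ∈ suppU d N K y, |tabT r Lc M N μ u w l y l'|
        ≤ ∑ _l : Fin (d + 1), ((d : ℝ) + 1) * (((2 * K + 1 : ℕ) : ℝ) ^ (d + 1) * B) := Finset.sum_le_sum fun l _ => hμ w l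
      _ = ((d : ℝ) + 1) * (((d : ℝ) + 1) * (((2 * K + 1 : ℕ) : ℝ) ^ (d + 1) * B)) := by simp
  have hpos : 0 ≤ ((d : ℝ) + 1) * (((d : ℝ) + 1) * (((2 * K + 1 : ℕ) : ℝ) ^ (d + 1) * B)) := by positivity
  calc ∑ w ∈ suppW d K₂ y, ∑ l : Fin (d + 1), ∑ μ : Fin (d + 1), ∑ u ∈ suppU d N K y, |tabT r Lc M N μ u w l y l'|
      ≤ ∑ _w ∈ suppW d K₂ y, ((d : ℝ) + 1) * (((d : ℝ) + 1) * (((2 * K + 1 : ℕ) : ℝ) ^ (d + 1) * B)) :=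
        Finset.sum_le_sum fun w _ => hl w
    _ = (suppW d K₂ y).card * (((d : ℝ) + 1) * (((d : ℝ) + 1) * (((2 * K + 1 : ℕ) : ℝ) ^ (d + 1) * B))) := by
        rw [Finset.sum_const, nsmul_eq_mul]
    _ ≤ ((2 * K₂ + 1 : ℕ) : ℝ) ^ (d + 1) * (((d : ℝ) + 1) * (((d : ℝ) + 1) * (((2 * K + 1 : ℕ) : ℝ) ^ (d + 1) * B))) :=
        mul_le_mul_of_nonneg_right (card_suppW_le K₂ y) hpos

end Support

end Summit.QuantumFields.BalabanUV.Beta.GAN24.TaylorRowLamTopTableAt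

end
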